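import Summits.KontsevichZagierPeriods.KontsevichZagierPeriods.Theorems.LinRedNormalFormArrangementNormalFormStubRebaseSimplePosOneFibreParSplit

/-!
# Stub `stub_rebaseSimplePosOne` (crux `ArrangementNormalForm`, line `janus-bands`, v6.2) —
part `SwapForms`: the dictionary of the coordinate swap `y ↔ t`

For the registered exponents `n₁ = 0`, `n₂ = 1` the literal one-fibre integrand with letter `0`,
`g(x') · 1/(y − ℓ₂(x')) · 1/t`, is SYMMETRIC in the distinguished base coordinate `y` and the
fibre coordinate `t`: both carry a simple pole with an `x'`-affine letter. This file is the
affine dictionary of the coordinate swap `w ↦ w ∘ (y t)` (part `Swap` proves the move), written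
with EXPLICIT forms (no new definitions):
* `(snoc d 0, d₀)` — an `x'`-form `d` as a `y`-free full-base form (`RebasePos.affF_liftB`);
* `invF c := (snoc (−c'/c_y) (1/c_y), −c₀/c_y) = (Y − c(x', 0))/c_y` — the transverse player of a
  bound `c`: `c(x', T) < Y ↔ T ≶ invF c` (`RebasePos.affF_invF`);
* `rowF c := (snoc (−c'/c_y) 0, −c₀/c_y) = −c(x', 0)/c_y` — the `Y`-free player of a row
  involving `y` (`RebasePos.affF_rowF`);
* the comparisons `rowP c`, `uP u`, `vP v` (`RebasePos.rowP_iff`, `uP_iff`, `vP_iff`) and the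
  constraint set `swC M u v = image rowP ∪ {uP u, vP v}` of the swapped band, with semantics
  `RebasePos.swC_iff` (registered as `rebaseSimplePos_swC_iff`: `w` satisfies the constraints
  iff `w ∘ (y t)` lies in the band `{rows, u < t < v}`), both-sided comparison of the fibre
  `RebasePos.swC_hlu`, and the provenance of the affine players `RebasePos.swC_players`
  (`Y`-free, `invF u`, or `invF v`).

References: M. Kontsevich, D. Zagier, *Periods* (2001), §1.2, rule (2).
-/

noncomputable section

open Set MeasureTheory MvPolynomial
open Literature.NumberTheory.Transcendental Literature.ModelTheory.ExponentialFields

namespace Summit.KontsevichZagierPeriods.ArrangementNormalForm.JanusBands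

namespace RebasePos

open SeparatePos

section SwapForms

variable {B : ℕ}

/-- A silent base coordinate is not `y`. -/
theorem castSucc_ne_yI (i : Fin B) :
    (Fin.castAdd 1 (Fin.castSucc i) : Fin (B + 1 + 1)) ≠ Fin.castAdd 1 (Fin.last B) :=
  fun h => (Fin.castSucc_lt_last i).ne (Fin.castAdd_injective _ _ h)

/-- The swap at `y`. -/
theorem swapEquiv_y : (Equiv.swap (Fin.castAdd 1 (Fin.last B)) (tI B)) (Fin.castAdd 1 (Fin.last B)) = tI B :=
  Equiv.swap_apply_left _ _

/-- The swap at `t`. -/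
theorem swapEquiv_t : (Equiv.swap (Fin.castAdd 1 (Fin.last B)) (tI B)) (tI B) = Fin.castAdd 1 (Fin.last B) :=
  Equiv.swap_apply_right _ _

/-- The swap fixes the silent base coordinates. -/
@[simp] theorem swapEquiv_x (i : Fin B) :
    (Equiv.swap (Fin.castAdd 1 (Fin.last B)) (tI B)) (Fin.castAdd 1 (Fin.castSucc i)) =
      Fin.castAdd 1 (Fin.castSucc i) :=
  Equiv.swap_apply_of_ne_of_ne (castSucc_ne_yI i) (castAdd_ne_tI _)

/-- The swap is an involution. -/
theorem swapYT_swapYT (z : Fin (B + 1 + 1) → ℝ) : (fun l : Fin (B + 1 + 1) => ((fun l : Fin (B + 1 + 1) => z ((Equiv.swap (Fin.castAdd 1 (Fin.last B)) (RebasePos.tI B)) l))) ((Equiv.swap (Fin.castAdd 1 (Fin.last B)) (RebasePos.tI B)) l)) = z := by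
  funext l
  simp [Equiv.swap_apply_self]

/-- `x'`-affine forms are unchanged by the swap. -/
theorem affB_swapYT (d : (Fin B → ℚ) × ℚ) (z : Fin (B + 1 + 1) → ℝ) :
    affB B 1 d (fun l : Fin (B + 1 + 1) => z ((Equiv.swap (Fin.castAdd 1 (Fin.last B)) (RebasePos.tI B)) l)) = affB B 1 d z := by
  simp only [affB, swapEquiv_x]

/-- Full-base forms after the swap: `c(x', y)` at `y := t`. -/
theorem affF_swapYT (c : (Fin (B + 1) → ℚ) × ℚ) (z : Fin (B + 1 + 1) → ℝ) :
    affF B 1 c (fun l : Fin (B + 1 + 1) => z ((Equiv.swap (Fin.castAdd 1 (Fin.last B)) (RebasePos.tI B)) l)) = (c.1 (Fin.last B) : ℝ) * z (tI B) + affB B 1 (restr B c) z := by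
  rw [affF_split, affB_swapYT, swapEquiv_y]

/-- The sup norm does not increase under the swap. -/
theorem norm_swapYT_le (z : Fin (B + 1 + 1) → ℝ) : ‖(fun l : Fin (B + 1 + 1) => z ((Equiv.swap (Fin.castAdd 1 (Fin.last B)) (RebasePos.tI B)) l))‖ ≤ ‖z‖ :=
  (pi_norm_le_iff_of_nonneg (norm_nonneg z)).2 fun _ => norm_le_pi_norm z _

/-- `liftF d` is `y`-free. -/
theorem liftF_last (d : (Fin B → ℚ) × ℚ) : ((((Fin.snoc d.1 0 : Fin (B + 1) → ℚ), d.2) : (Fin (B + 1) → ℚ) × ℚ)).1 (Fin.last B) = 0 := by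
  simp

/-- `liftF d` restricted to `x'` is `d`. -/
theorem restr_liftF (d : (Fin B → ℚ) × ℚ) : restr B (((Fin.snoc d.1 0 : Fin (B + 1) → ℚ), d.2) : (Fin (B + 1) → ℚ) × ℚ) = d := by
  ext <;> simp [restr]

/-- `affB` of a sum. -/
theorem affB_addYT (d d' : (Fin B → ℚ) × ℚ) (z : Fin (B + 1 + 1) → ℝ) :
    affB B 1 (d + d') z = affB B 1 d z + affB B 1 d' z := by
  simp only [affB, Prod.fst_add, Prod.snd_add, Pi.add_apply, Rat.cast_add, add_mul,
    Finset.sum_add_distrib]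
  ring

/-- `affB` of the zero form. -/
theorem affB_zeroYT (z : Fin (B + 1 + 1) → ℝ) : affB B 1 (0 : (Fin B → ℚ) × ℚ) z = 0 := by
  simp [affB]

/-- The `Y`-slope of `invF c` is `1/c_y`. -/
theorem invF_last (c : (Fin (B + 1) → ℚ) × ℚ) : ((((Fin.snoc (fun i : Fin B => -c.1 (Fin.castSucc i) / c.1 (Fin.last B)) (1 / c.1 (Fin.last B)) : Fin (B + 1) → ℚ), -c.2 / c.1 (Fin.last B)) : (Fin (B + 1) → ℚ) × ℚ)).1 (Fin.last B) = 1 / c.1 (Fin.last B) := by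
  simp

/-- `invF c` evaluates to `(Y − c(x', 0))/c_y`. -/
theorem affF_invF (c : (Fin (B + 1) → ℚ) × ℚ) (hc : c.1 (Fin.last B) ≠ 0) (z : Fin (B + 1 + 1) → ℝ) :
    affF B 1 (((Fin.snoc (fun i : Fin B => -c.1 (Fin.castSucc i) / c.1 (Fin.last B)) (1 / c.1 (Fin.last B)) : Fin (B + 1) → ℚ), -c.2 / c.1 (Fin.last B)) : (Fin (B + 1) → ℚ) × ℚ) z =
      (z (Fin.castAdd 1 (Fin.last B)) - affB B 1 (restr B c) z) / (c.1 (Fin.last B) : ℝ) := by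
  have hc' : (c.1 (Fin.last B) : ℝ) ≠ 0 := by exact_mod_cast hc
  rw [eq_div_iff hc']
  simp only [affF, affB, restr, Fin.sum_univ_castSucc, Fin.snoc_castSucc, Fin.snoc_last,
    Rat.cast_div, Rat.cast_neg, Rat.cast_one, add_mul, Finset.sum_mul]
  have h : ∀ i : Fin B, -(c.1 (Fin.castSucc i) : ℝ) / (c.1 (Fin.last B) : ℝ) *
      z (Fin.castAdd 1 (Fin.castSucc i)) * (c.1 (Fin.last B) : ℝ) =
      -((c.1 (Fin.castSucc i) : ℝ) * z (Fin.castAdd 1 (Fin.castSucc i))) := fun i => by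
    field_simp
  simp only [h, Finset.sum_neg_distrib]
  field_simp
  ring

/-- `rowF c` is `Y`-free. -/
theorem rowF_last (c : (Fin (B + 1) → ℚ) × ℚ) : ((((Fin.snoc (fun i : Fin B => -c.1 (Fin.castSucc i) / c.1 (Fin.last B)) 0 : Fin (B + 1) → ℚ), -c.2 / c.1 (Fin.last B)) : (Fin (B + 1) → ℚ) × ℚ)).1 (Fin.last B) = 0 := by
  simp

/-- `rowF c` evaluates to `−c(x', 0)/c_y`. -/
theorem affF_rowF (c : (Fin (B + 1) → ℚ) × ℚ) (hc : c.1 (Fin.last B) ≠ 0) (z : Fin (B + 1 + 1) → ℝ) :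
    affF B 1 (((Fin.snoc (fun i : Fin B => -c.1 (Fin.castSucc i) / c.1 (Fin.last B)) 0 : Fin (B + 1) → ℚ), -c.2 / c.1 (Fin.last B)) : (Fin (B + 1) → ℚ) × ℚ) z = -affB B 1 (restr B c) z / (c.1 (Fin.last B) : ℝ) := by
  have hc' : (c.1 (Fin.last B) : ℝ) ≠ 0 := by exact_mod_cast hc
  rw [eq_div_iff hc']
  simp only [affF, affB, restr, Fin.sum_univ_castSucc, Fin.snoc_castSucc, Fin.snoc_last,
    Rat.cast_div, Rat.cast_neg, Rat.cast_zero, zero_mul, add_zero, add_mul, Finset.sum_mul]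
  have h : ∀ i : Fin B, -(c.1 (Fin.castSucc i) : ℝ) / (c.1 (Fin.last B) : ℝ) *
      z (Fin.castAdd 1 (Fin.castSucc i)) * (c.1 (Fin.last B) : ℝ) =
      -((c.1 (Fin.castSucc i) : ℝ) * z (Fin.castAdd 1 (Fin.castSucc i))) := fun i => by
    field_simp
  simp only [h, Finset.sum_neg_distrib]
  field_simp
  ring

/-- The affine player of the literal one-fibre text is `affF`. -/
theorem pv_inr_one (c : (Fin (B + 1) → ℚ) × ℚ) (z : Fin (B + 1 + 1) → ℝ) :
    pv (Sum.inr c : Fin 1 ⊕ ((Fin (B + 1) → ℚ) × ℚ)) z = affF B 1 c z := rfl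

/-- The fibre player of the literal one-fibre text is `t`. -/
theorem pv_inl_one (z : Fin (B + 1 + 1) → ℝ) :
    pv (Sum.inl 0 : Fin 1 ⊕ ((Fin (B + 1) → ℚ) × ℚ)) z = z (tI B) := rfl

/-- Semantics of `rowP c`: the row `0 < c(x', T)` after the swap. -/
theorem rowP_iff (c : (Fin (B + 1) → ℚ) × ℚ) (z : Fin (B + 1 + 1) → ℝ) :
    pv ((if c.1 (Fin.last B) = 0 then ((Sum.inr 0, Sum.inr c) : ((Fin 1 ⊕ ((Fin (B + 1) → ℚ) × ℚ)) × (Fin 1 ⊕ ((Fin (B + 1) → ℚ) × ℚ)))) else if 0 < c.1 (Fin.last B) then (Sum.inr (((Fin.snoc (fun i : Fin B => -c.1 (Fin.castSucc i) / c.1 (Fin.last B)) 0 : Fin (B + 1) → ℚ), -c.2 / c.1 (Fin.last B)) : (Fin (B + 1) → ℚ) × ℚ), Sum.inl 0) else (Sum.inl 0, Sum.inr (((Fin.snoc (fun i : Fin B => -c.1 (Fin.castSucc i) / c.1 (Fin.last B)) 0 : Fin (B + 1) → ℚ), -c.2 / c.1 (Fin.last B)) : (Fin (B + 1) → ℚ)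 × ℚ)))).1 z < pv ((if c.1 (Fin.last B) = 0 then ((Sum.inr 0, Sum.inr c) : ((Fin 1 ⊕ ((Fin (B + 1) → ℚ) × ℚ)) × (Fin 1 ⊕ ((Fin (B + 1) → ℚ) × ℚ)))) else if 0 < c.1 (Fin.last B) then (Sum.inr (((Fin.snoc (fun i : Fin B => -c.1 (Fin.castSucc i) / c.1 (Fin.last B)) 0 : Fin (B + 1) → ℚ), -c.2 / c.1 (Fin.last B)) : (Fin (B + 1) → ℚ) × ℚ), Sum.inl 0) else (Sum.inl 0, Sum.inr (((Fin.snoc (fun i : Fin B => -c.1 (Fin.castSucc i) / c.1 (Fin.last B)) 0 : Fin (B + 1) → ℚ), -c.2 / c.1 (Fin.last B)) : (Fin (B + 1) → ℚ) × ℚ)))).2 z ↔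
      0 < (c.1 (Fin.last B) : ℝ) * z (tI B) + affB B 1 (restr B c) z := by
  split_ifs with h0 hpos
  · rw [pv_inr_one, pv_inr_one, affF_zero'', affF_split, h0]
    simp
  · have hpos' : (0 : ℝ) < c.1 (Fin.last B) := by exact_mod_cast hpos
    rw [pv_inr_one, pv_inl_one, affF_rowF c h0, div_lt_iff₀ hpos']
    constructor <;> intro h <;> linarith
  · have hneg : (c.1 (Fin.last B) : ℝ) < 0 := by
      have : c.1 (Fin.last B) < 0 := lt_of_le_of_ne (not_lt.1 hpos) h0
      exact_mod_cast this
    rw [pv_inr_one, pv_inl_one, affF_rowF c h0, lt_div_iff_of_neg hneg]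
    constructor <;> intro h <;> linarith

/-- Semantics of `uP u`: the lower bound `u(x', T) < Y` after the swap. -/
theorem uP_iff (u : (Fin (B + 1) → ℚ) × ℚ) (hu : u.1 (Fin.last B) ≠ 0) (z : Fin (B + 1 + 1) → ℝ) :
    pv ((if 0 < u.1 (Fin.last B) then ((Sum.inl 0, Sum.inr (((Fin.snoc (fun i : Fin B => -u.1 (Fin.castSucc i) / u.1 (Fin.last B)) (1 / u.1 (Fin.last B)) : Fin (B + 1) → ℚ), -u.2 / u.1 (Fin.last B)) : (Fin (B + 1) → ℚ) × ℚ)) : ((Fin 1 ⊕ ((Fin (B + 1) → ℚ) × ℚ)) × (Fin 1 ⊕ ((Fin (B + 1) → ℚ) × ℚ)))) else (Sum.inr (((Fin.snoc (fun i : Fin B => -u.1 (Fin.castSucc i) / u.1 (Fin.last B)) (1 / u.1 (Fin.last B)) : Fin (B + 1) → ℚ), -u.2 / u.1 (Fin.last B)) : (Fin (B + 1) → ℚ) × ℚ), Sum.inl 0))).1 z < pv ((if 0 < u.1 (Fin.last B) then ((Sum.inl 0, Sum.inr (((Fin.snoc (fun i : Fin B => -u.1 (Fin.castSucc i) / u.1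 (Fin.last B)) (1 / u.1 (Fin.last B)) : Fin (B + 1) → ℚ), -u.2 / u.1 (Fin.last B)) : (Fin (B + 1) → ℚ) × ℚ)) : ((Fin 1 ⊕ ((Fin (B + 1) → ℚ) × ℚ)) × (Fin 1 ⊕ ((Fin (B + 1) → ℚ) × ℚ)))) else (Sum.inr (((Fin.snoc (fun i : Fin B => -u.1 (Fin.castSucc i) / u.1 (Fin.last B)) (1 / u.1 (Fin.last B)) : Fin (B + 1) → ℚ), -u.2 / u.1 (Fin.last B)) : (Fin (B + 1) → ℚ) × ℚ), Sum.inl 0))).2 z ↔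
      (u.1 (Fin.last B) : ℝ) * z (tI B) + affB B 1 (restr B u) z < z (Fin.castAdd 1 (Fin.last B)) := by
  split_ifs with hpos
  · have hpos' : (0 : ℝ) < u.1 (Fin.last B) := by exact_mod_cast hpos
    rw [pv_inr_one, pv_inl_one, affF_invF u hu, lt_div_iff₀ hpos']
    constructor <;> intro h <;> linarith
  · have hneg : (u.1 (Fin.last B) : ℝ) < 0 := by
      have : u.1 (Fin.last B) < 0 := lt_of_le_of_ne (not_lt.1 hpos) hu
      exact_mod_cast this
    rw [pv_inr_one, pv_inl_one, affF_invF u hu, div_lt_iff_of_neg hneg]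
    constructor <;> intro h <;> linarith

/-- Semantics of `vP v`: the upper bound `Y < v(x', T)` after the swap. -/
theorem vP_iff (v : (Fin (B + 1) → ℚ) × ℚ) (hv : v.1 (Fin.last B) ≠ 0) (z : Fin (B + 1 + 1) → ℝ) :
    pv ((if 0 < v.1 (Fin.last B) then ((Sum.inr (((Fin.snoc (fun i : Fin B => -v.1 (Fin.castSucc i) / v.1 (Fin.last B)) (1 / v.1 (Fin.last B)) : Fin (B + 1) → ℚ), -v.2 / v.1 (Fin.last B)) : (Fin (B + 1) → ℚ) × ℚ), Sum.inl 0) : ((Fin 1 ⊕ ((Fin (B + 1) → ℚ) × ℚ)) × (Fin 1 ⊕ ((Fin (B + 1) → ℚ) × ℚ)))) else (Sum.inl 0, Sum.inr (((Fin.snoc (fun i : Fin B => -v.1 (Fin.castSucc i) / v.1 (Fin.last B)) (1 / v.1 (Fin.last B)) : Fin (B + 1) → ℚ), -v.2 / v.1 (Fin.last B)) : (Fin (B + 1) → ℚ) × ℚ)))).1 z < pv ((if 0 < v.1 (Fin.last B) then ((Sum.inr (((Fin.snoc (fun i : Fin B => -v.1 (Fin.castSucc i) / v.1 (Fin.last B))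 (1 / v.1 (Fin.last B)) : Fin (B + 1) → ℚ), -v.2 / v.1 (Fin.last B)) : (Fin (B + 1) → ℚ) × ℚ), Sum.inl 0) : ((Fin 1 ⊕ ((Fin (B + 1) → ℚ) × ℚ)) × (Fin 1 ⊕ ((Fin (B + 1) → ℚ) × ℚ)))) else (Sum.inl 0, Sum.inr (((Fin.snoc (fun i : Fin B => -v.1 (Fin.castSucc i) / v.1 (Fin.last B)) (1 / v.1 (Fin.last B)) : Fin (B + 1) → ℚ), -v.2 / v.1 (Fin.last B)) : (Fin (B + 1) → ℚ) × ℚ)))).2 z ↔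
      z (Fin.castAdd 1 (Fin.last B)) < (v.1 (Fin.last B) : ℝ) * z (tI B) + affB B 1 (restr B v) z := by
  split_ifs with hpos
  · have hpos' : (0 : ℝ) < v.1 (Fin.last B) := by exact_mod_cast hpos
    rw [pv_inr_one, pv_inl_one, affF_invF v hv, div_lt_iff₀ hpos']
    constructor <;> intro h <;> linarith
  · have hneg : (v.1 (Fin.last B) : ℝ) < 0 := by
      have : v.1 (Fin.last B) < 0 := lt_of_le_of_ne (not_lt.1 hpos) hv
      exact_mod_cast this
    rw [pv_inr_one, pv_inl_one, affF_invF v hv, lt_div_iff_of_neg hneg]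
    constructor <;> intro h <;> linarith

variable {m' : ℕ}

/-- **The swapped band is the preimage of the band**: `w` satisfies the constraints
`swC M u v` iff `w ∘ (y t)` lies in the band. -/
theorem swC_iff (M : Fin m' → (Fin (B + 1) → ℚ) × ℚ) (u v : (Fin (B + 1) → ℚ) × ℚ)
    (hu : u.1 (Fin.last B) ≠ 0) (hv : v.1 (Fin.last B) ≠ 0) (w : Fin (B + 1 + 1) → ℝ) :
    (∀ q ∈ ((Finset.univ.image fun j => (if (M j).1 (Fin.last B) = 0 then ((Sum.inr 0, Sum.inr (M j)) : ((Fin 1 ⊕ ((Fin (B + 1) → ℚ) × ℚ)) × (Fin 1 ⊕ ((Fin (B + 1) → ℚ) × ℚ)))) else if 0 < (M j).1 (Fin.last B) then (Sum.inr (((Fin.snoc (fun i : Fin B => -(M j).1 (Fin.castSucc i) / (M j).1 (Fin.last B)) 0 : Fin (B + 1) → ℚ), -(M j).2 / (M j).1 (Fin.last B)) : (Fin (B + 1) → ℚ) × ℚ), Sum.inl 0) else (Sum.inl 0, Sum.inr (((Fin.snoc (fun i : Fin B => -(M j).1 (Fin.castSucc i) / (M j).1 (Fin.last B)) 0 : Fin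 (B + 1) → ℚ), -(M j).2 / (M j).1 (Fin.last B)) : (Fin (B + 1) → ℚ) × ℚ)))) ∪ (({(if 0 < u.1 (Fin.last B) then ((Sum.inl 0, Sum.inr (((Fin.snoc (fun i : Fin B => -u.1 (Fin.castSucc i) / u.1 (Fin.last B)) (1 / u.1 (Fin.last B)) : Fin (B + 1) → ℚ), -u.2 / u.1 (Fin.last B)) : (Fin (B + 1) → ℚ) × ℚ)) : ((Fin 1 ⊕ ((Fin (B + 1) → ℚ) × ℚ)) × (Fin 1 ⊕ ((Fin (B + 1) → ℚ) × ℚ)))) else (Sum.inr (((Fin.snoc (fun i : Fin B => -u.1 (Fin.castSucc i) / u.1 (Fin.last B)) (1 / u.1 (Fin.last B)) : Fin (B + 1) → ℚ), -u.2 / u.1 (Fin.last B)) : (Fin (B + 1) → ℚ) × ℚ), Sum.inl 0)), (if 0 < v.1 (Fin.last B) then ((Sum.inr (((Fin.snoc (fun i : Fin B => -v.1 (Fin.castSucc i) / v.1 (Fin.last B)) (1 / v.1 (Fin.last B)) : Fin (B + 1) → ℚ), -v.2 / v.1 (Fin.last B)) : (Fin (B + 1) → ℚ) × ℚ), Sum.inl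 0) : ((Fin 1 ⊕ ((Fin (B + 1) → ℚ) × ℚ)) × (Fin 1 ⊕ ((Fin (B + 1) → ℚ) × ℚ)))) else (Sum.inl 0, Sum.inr (((Fin.snoc (fun i : Fin B => -v.1 (Fin.castSucc i) / v.1 (Fin.last B)) (1 / v.1 (Fin.last B)) : Fin (B + 1) → ℚ), -v.2 / v.1 (Fin.last B)) : (Fin (B + 1) → ℚ) × ℚ)))}) : Finset ((Fin 1 ⊕ ((Fin (B + 1) → ℚ) × ℚ)) × (Fin 1 ⊕ ((Fin (B + 1) → ℚ) × ℚ))))), pv q.1 w < pv q.2 w) ↔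
      (fun l : Fin (B + 1 + 1) => w ((Equiv.swap (Fin.castAdd 1 (Fin.last B)) (RebasePos.tI B)) l)) ∈ gDom B 1 m' M (fun _ => Sum.inr u) (fun _ => Sum.inr v) := by
  rw [mem_gDom_one]
  simp only [affF_swapYT]
  rw [show w ((Equiv.swap (Fin.castAdd 1 (Fin.last B)) (tI B)) (Fin.natAdd (B + 1) 0)) =
    w (Fin.castAdd 1 (Fin.last B)) by rw [swapEquiv_t]]
  constructor
  · intro h
    refine ⟨fun j => ?_, ?_, ?_⟩
    · have hq := h ((if (M j).1 (Fin.last B) = 0 then ((Sum.inr 0, Sum.inr (M j)) : ((Fin 1 ⊕ ((Fin (B + 1) → ℚ) × ℚ)) × (Fin 1 ⊕ ((Fin (B + 1) → ℚ) × ℚ)))) else if 0 < (M j).1 (Fin.last B) then (Sum.inr (((Fin.snoc (fun i : Fin B => -(M j).1 (Fin.castSucc i) / (M j).1 (Fin.last B)) 0 : Fin (B + 1) → ℚ), -(M j).2 / (M j).1 (Fin.last B)) : (Fin (B + 1) → ℚ) × ℚ), Sum.inl 0) else (Sum.inl 0, Sum.inr (((Fin.snoc (fun i : Fin B => -(M j).1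 (Fin.castSucc i) / (M j).1 (Fin.last B)) 0 : Fin (B + 1) → ℚ), -(M j).2 / (M j).1 (Fin.last B)) : (Fin (B + 1) → ℚ) × ℚ)))) (Finset.mem_union_left _ (Finset.mem_image_of_mem _ (Finset.mem_univ j)))
      rwa [rowP_iff] at hq
    · have hq := h ((if 0 < u.1 (Fin.last B) then ((Sum.inl 0, Sum.inr (((Fin.snoc (fun i : Fin B => -u.1 (Fin.castSucc i) / u.1 (Fin.last B)) (1 / u.1 (Fin.last B)) : Fin (B + 1) → ℚ), -u.2 / u.1 (Fin.last B)) : (Fin (B + 1) → ℚ) × ℚ)) : ((Fin 1 ⊕ ((Fin (B + 1) → ℚ) × ℚ)) × (Fin 1 ⊕ ((Fin (B + 1) → ℚ) × ℚ)))) else (Sum.inr (((Fin.snoc (fun i : Fin B => -u.1 (Fin.castSucc i) / u.1 (Fin.last B)) (1 / u.1 (Fin.last B)) : Fin (B + 1) → ℚ), -u.2 / u.1 (Fin.last B)) : (Fin (B + 1) → ℚ) × ℚ), Sum.inl 0))) (Finset.mem_union_right _ (Finset.mem_insert_self _ _))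
      rwa [uP_iff u hu] at hq
    · have hq := h ((if 0 < v.1 (Fin.last B) then ((Sum.inr (((Fin.snoc (fun i : Fin B => -v.1 (Fin.castSucc i) / v.1 (Fin.last B)) (1 / v.1 (Fin.last B)) : Fin (B + 1) → ℚ), -v.2 / v.1 (Fin.last B)) : (Fin (B + 1) → ℚ) × ℚ), Sum.inl 0) : ((Fin 1 ⊕ ((Fin (B + 1) → ℚ) × ℚ)) × (Fin 1 ⊕ ((Fin (B + 1) → ℚ) × ℚ)))) else (Sum.inl 0, Sum.inr (((Fin.snoc (fun i : Fin B => -v.1 (Fin.castSucc i) / v.1 (Fin.last B)) (1 / v.1 (Fin.last B)) : Fin (B + 1) → ℚ), -v.2 / v.1 (Fin.last B)) : (Fin (B + 1) → ℚ) × ℚ)))) (Finset.mem_union_right _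
        (Finset.mem_insert_of_mem (Finset.mem_singleton_self _)))
      rwa [vP_iff v hv] at hq
  · rintro ⟨hrow, h1, h2⟩ q hq
    rcases Finset.mem_union.1 hq with hq | hq
    · obtain ⟨j, -, rfl⟩ := Finset.mem_image.1 hq
      rw [rowP_iff]
      exact hrow j
    · rcases Finset.mem_insert.1 hq with rfl | hq
      · rw [uP_iff u hu]
        exact h1
      · rw [Finset.mem_singleton] at hq
        rw [hq, vP_iff v hv]
        exact h2

/-- Every fibre of the swapped band is compared from below and from above (bounds of the same
sign in `y`). -/
theorem swC_hlu (M : Fin m' → (Fin (B + 1) → ℚ) × ℚ) (u v : (Fin (B + 1) → ℚ) × ℚ)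
    (hsame : 0 < u.1 (Fin.last B) ↔ 0 < v.1 (Fin.last B)) (i : Fin 1) :
    (∃ q ∈ ((Finset.univ.image fun j => (if (M j).1 (Fin.last B) = 0 then ((Sum.inr 0, Sum.inr (M j)) : ((Fin 1 ⊕ ((Fin (B + 1) → ℚ) × ℚ)) × (Fin 1 ⊕ ((Fin (B + 1) → ℚ) × ℚ)))) else if 0 < (M j).1 (Fin.last B) then (Sum.inr (((Fin.snoc (fun i : Fin B => -(M j).1 (Fin.castSucc i) / (M j).1 (Fin.last B)) 0 : Fin (B + 1) → ℚ), -(M j).2 / (M j).1 (Fin.last B)) : (Fin (B + 1) → ℚ) × ℚ), Sum.inl 0) else (Sum.inl 0, Sum.inr (((Fin.snoc (fun i : Fin B => -(M j).1 (Fin.castSucc i) / (M j).1 (Fin.last B)) 0 : Fin (B + 1) → ℚ), -(M j).2 / (M j).1 (Fin.last B)) : (Fin (B + 1) → ℚ) × ℚ)))) ∪ (({(if 0 < u.1 (Fin.last B) then ((Sum.inl 0, Sum.inr (((Fin.snoc (fun i : Fin B => -u.1 (Fin.castSucc i) / u.1 (Fin.last B)) (1 / u.1 (Fin.last B)) : Fin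 (B + 1) → ℚ), -u.2 / u.1 (Fin.last B)) : (Fin (B + 1) → ℚ) × ℚ)) : ((Fin 1 ⊕ ((Fin (B + 1) → ℚ) × ℚ)) × (Fin 1 ⊕ ((Fin (B + 1) → ℚ) × ℚ)))) else (Sum.inr (((Fin.snoc (fun i : Fin B => -u.1 (Fin.castSucc i) / u.1 (Fin.last B)) (1 / u.1 (Fin.last B)) : Fin (B + 1) → ℚ), -u.2 / u.1 (Fin.last B)) : (Fin (B + 1) → ℚ) × ℚ), Sum.inl 0)), (if 0 < v.1 (Fin.last B) then ((Sum.inr (((Fin.snoc (fun i : Fin B => -v.1 (Fin.castSucc i) / v.1 (Fin.last B)) (1 / v.1 (Fin.last B)) : Fin (B + 1) → ℚ), -v.2 / v.1 (Fin.last B)) : (Fin (B + 1) → ℚ) × ℚ), Sum.inl 0) : ((Fin 1 ⊕ ((Fin (B + 1) → ℚ) × ℚ)) × (Fin 1 ⊕ ((Fin (B + 1) → ℚ) × ℚ)))) else (Sum.inl 0, Sum.inr (((Fin.snoc (fun i : Fin B => -v.1 (Fin.castSucc i) / v.1 (Fin.last B)) (1 / v.1 (Fin.last B)) : Fin (B +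 1) → ℚ), -v.2 / v.1 (Fin.last B)) : (Fin (B + 1) → ℚ) × ℚ)))}) : Finset ((Fin 1 ⊕ ((Fin (B + 1) → ℚ) × ℚ)) × (Fin 1 ⊕ ((Fin (B + 1) → ℚ) × ℚ))))), q.2 = Sum.inl i) ∧ (∃ q ∈ ((Finset.univ.image fun j => (if (M j).1 (Fin.last B) = 0 then ((Sum.inr 0, Sum.inr (M j)) : ((Fin 1 ⊕ ((Fin (B + 1) → ℚ) × ℚ)) × (Fin 1 ⊕ ((Fin (B + 1) → ℚ) × ℚ)))) else if 0 < (M j).1 (Fin.last B) then (Sum.inr (((Fin.snoc (fun i : Fin B => -(M j).1 (Fin.castSucc i) / (M j).1 (Fin.last B)) 0 : Fin (B + 1) → ℚ), -(M j).2 / (M j).1 (Fin.last B)) : (Fin (B + 1) → ℚ) × ℚ), Sum.inl 0) else (Sum.inl 0, Sum.inr (((Fin.snoc (fun i : Fin B => -(M j).1 (Fin.castSucc i) / (M j).1 (Fin.last B)) 0 : Fin (B + 1) → ℚ), -(M j).2 / (M j).1 (Fin.last B)) : (Fin (B + 1) → ℚ) × ℚ)))) ∪ (({(if 0 < u.1 (Fin.last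 B) then ((Sum.inl 0, Sum.inr (((Fin.snoc (fun i : Fin B => -u.1 (Fin.castSucc i) / u.1 (Fin.last B)) (1 / u.1 (Fin.last B)) : Fin (B + 1) → ℚ), -u.2 / u.1 (Fin.last B)) : (Fin (B + 1) → ℚ) × ℚ)) : ((Fin 1 ⊕ ((Fin (B + 1) → ℚ) × ℚ)) × (Fin 1 ⊕ ((Fin (B + 1) → ℚ) × ℚ)))) else (Sum.inr (((Fin.snoc (fun i : Fin B => -u.1 (Fin.castSucc i) / u.1 (Fin.last B)) (1 / u.1 (Fin.last B)) : Fin (B + 1) → ℚ), -u.2 / u.1 (Fin.last B)) : (Fin (B + 1) → ℚ) × ℚ), Sum.inl 0)), (if 0 < v.1 (Fin.last B) then ((Sum.inr (((Fin.snoc (fun i : Fin B => -v.1 (Fin.castSucc i) / v.1 (Fin.last B)) (1 / v.1 (Fin.last B)) : Fin (B + 1) → ℚ), -v.2 / v.1 (Fin.last B)) : (Fin (B + 1) → ℚ) × ℚ), Sum.inl 0) : ((Fin 1 ⊕ ((Fin (B + 1) → ℚ) × ℚ)) × (Fin 1 ⊕ ((Fin (B + 1) → ℚ) × ℚ)))) else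 (Sum.inl 0, Sum.inr (((Fin.snoc (fun i : Fin B => -v.1 (Fin.castSucc i) / v.1 (Fin.last B)) (1 / v.1 (Fin.last B)) : Fin (B + 1) → ℚ), -v.2 / v.1 (Fin.last B)) : (Fin (B + 1) → ℚ) × ℚ)))}) : Finset ((Fin 1 ⊕ ((Fin (B + 1) → ℚ) × ℚ)) × (Fin 1 ⊕ ((Fin (B + 1) → ℚ) × ℚ))))), q.1 = Sum.inl i) := by
  obtain rfl : i = 0 := Subsingleton.elim i 0
  have hu : (if 0 < u.1 (Fin.last B) then ((Sum.inl 0, Sum.inr (((Fin.snoc (fun i : Fin B => -u.1 (Fin.castSucc i) / u.1 (Fin.last B)) (1 / u.1 (Fin.last B)) : Fin (B + 1) → ℚ), -u.2 / u.1 (Fin.last B)) : (Fin (B + 1) → ℚ) × ℚ)) : ((Fin 1 ⊕ ((Fin (B + 1) → ℚ) × ℚ)) × (Fin 1 ⊕ ((Fin (B + 1) → ℚ) × ℚ)))) else (Sum.inr (((Fin.snoc (fun i : Fin B => -u.1 (Fin.castSucc i) / u.1 (Fin.last B)) (1 / u.1 (Fin.last B)) : Fin (B + 1) → ℚ), -u.2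 / u.1 (Fin.last B)) : (Fin (B + 1) → ℚ) × ℚ), Sum.inl 0)) ∈ ((Finset.univ.image fun j => (if (M j).1 (Fin.last B) = 0 then ((Sum.inr 0, Sum.inr (M j)) : ((Fin 1 ⊕ ((Fin (B + 1) → ℚ) × ℚ)) × (Fin 1 ⊕ ((Fin (B + 1) → ℚ) × ℚ)))) else if 0 < (M j).1 (Fin.last B) then (Sum.inr (((Fin.snoc (fun i : Fin B => -(M j).1 (Fin.castSucc i) / (M j).1 (Fin.last B)) 0 : Fin (B + 1) → ℚ), -(M j).2 / (M j).1 (Fin.last B)) : (Fin (B + 1) → ℚ) × ℚ), Sum.inl 0) else (Sum.inl 0, Sum.inr (((Fin.snoc (fun i : Fin B => -(M j).1 (Fin.castSucc i) / (M j).1 (Fin.last B)) 0 : Fin (B + 1) → ℚ), -(M j).2 / (M j).1 (Fin.last B)) : (Fin (B + 1) → ℚ) × ℚ)))) ∪ (({(if 0 < u.1 (Fin.last B) then ((Sum.inl 0, Sum.inr (((Fin.snoc (fun i : Fin B => -u.1 (Fin.castSucc i) / u.1 (Fin.last B)) (1 / u.1 (Fin.last B)) : Fin (B + 1) → ℚ),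 -u.2 / u.1 (Fin.last B)) : (Fin (B + 1) → ℚ) × ℚ)) : ((Fin 1 ⊕ ((Fin (B + 1) → ℚ) × ℚ)) × (Fin 1 ⊕ ((Fin (B + 1) → ℚ) × ℚ)))) else (Sum.inr (((Fin.snoc (fun i : Fin B => -u.1 (Fin.castSucc i) / u.1 (Fin.last B)) (1 / u.1 (Fin.last B)) : Fin (B + 1) → ℚ), -u.2 / u.1 (Fin.last B)) : (Fin (B + 1) → ℚ) × ℚ), Sum.inl 0)), (if 0 < v.1 (Fin.last B) then ((Sum.inr (((Fin.snoc (fun i : Fin B => -v.1 (Fin.castSucc i) / v.1 (Fin.last B)) (1 / v.1 (Fin.last B)) : Fin (B + 1) → ℚ), -v.2 / v.1 (Fin.last B)) : (Fin (B + 1) → ℚ) × ℚ), Sum.inl 0) : ((Fin 1 ⊕ ((Fin (B + 1) → ℚ) × ℚ)) × (Fin 1 ⊕ ((Fin (B + 1) → ℚ) × ℚ)))) else (Sum.inl 0, Sum.inr (((Fin.snoc (fun i : Fin B => -v.1 (Fin.castSucc i) / v.1 (Fin.last B)) (1 / v.1 (Fin.last B)) : Fin (B + 1) → ℚ), -v.2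 / v.1 (Fin.last B)) : (Fin (B + 1) → ℚ) × ℚ)))}) : Finset ((Fin 1 ⊕ ((Fin (B + 1) → ℚ) × ℚ)) × (Fin 1 ⊕ ((Fin (B + 1) → ℚ) × ℚ))))) := Finset.mem_union_right _ (Finset.mem_insert_self _ _)
  have hv : (if 0 < v.1 (Fin.last B) then ((Sum.inr (((Fin.snoc (fun i : Fin B => -v.1 (Fin.castSucc i) / v.1 (Fin.last B)) (1 / v.1 (Fin.last B)) : Fin (B + 1) → ℚ), -v.2 / v.1 (Fin.last B)) : (Fin (B + 1) → ℚ) × ℚ), Sum.inl 0) : ((Fin 1 ⊕ ((Fin (B + 1) → ℚ) × ℚ)) × (Fin 1 ⊕ ((Fin (B + 1) → ℚ) × ℚ)))) else (Sum.inl 0, Sum.inr (((Fin.snoc (fun i : Fin B => -v.1 (Fin.castSucc i) / v.1 (Fin.last B)) (1 / v.1 (Fin.last B)) : Fin (B + 1) → ℚ), -v.2 / v.1 (Fin.last B)) : (Fin (B + 1) → ℚ) × ℚ))) ∈ ((Finset.univ.image fun j => (if (M j).1 (Fin.last B) = 0 then ((Sum.inr 0, Sum.inr (M j)) : ((Fin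 1 ⊕ ((Fin (B + 1) → ℚ) × ℚ)) × (Fin 1 ⊕ ((Fin (B + 1) → ℚ) × ℚ)))) else if 0 < (M j).1 (Fin.last B) then (Sum.inr (((Fin.snoc (fun i : Fin B => -(M j).1 (Fin.castSucc i) / (M j).1 (Fin.last B)) 0 : Fin (B + 1) → ℚ), -(M j).2 / (M j).1 (Fin.last B)) : (Fin (B + 1) → ℚ) × ℚ), Sum.inl 0) else (Sum.inl 0, Sum.inr (((Fin.snoc (fun i : Fin B => -(M j).1 (Fin.castSucc i) / (M j).1 (Fin.last B)) 0 : Fin (B + 1) → ℚ), -(M j).2 / (M j).1 (Fin.last B)) : (Fin (B + 1) → ℚ) × ℚ)))) ∪ (({(if 0 < u.1 (Fin.last B) then ((Sum.inl 0, Sum.inr (((Fin.snoc (fun i : Fin B => -u.1 (Fin.castSucc i) / u.1 (Fin.last B)) (1 / u.1 (Fin.last B)) : Fin (B + 1) → ℚ), -u.2 / u.1 (Fin.last B)) : (Fin (B + 1) → ℚ) × ℚ)) : ((Fin 1 ⊕ ((Fin (B + 1) → ℚ) × ℚ)) × (Fin 1 ⊕ ((Fin (B + 1) → ℚ) × ℚ))))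 else (Sum.inr (((Fin.snoc (fun i : Fin B => -u.1 (Fin.castSucc i) / u.1 (Fin.last B)) (1 / u.1 (Fin.last B)) : Fin (B + 1) → ℚ), -u.2 / u.1 (Fin.last B)) : (Fin (B + 1) → ℚ) × ℚ), Sum.inl 0)), (if 0 < v.1 (Fin.last B) then ((Sum.inr (((Fin.snoc (fun i : Fin B => -v.1 (Fin.castSucc i) / v.1 (Fin.last B)) (1 / v.1 (Fin.last B)) : Fin (B + 1) → ℚ), -v.2 / v.1 (Fin.last B)) : (Fin (B + 1) → ℚ) × ℚ), Sum.inl 0) : ((Fin 1 ⊕ ((Fin (B + 1) → ℚ) × ℚ)) × (Fin 1 ⊕ ((Fin (B + 1) → ℚ) × ℚ)))) else (Sum.inl 0, Sum.inr (((Fin.snoc (fun i : Fin B => -v.1 (Fin.castSucc i) / v.1 (Fin.last B)) (1 / v.1 (Fin.last B)) : Fin (B + 1) → ℚ), -v.2 / v.1 (Fin.last B)) : (Fin (B + 1) → ℚ) × ℚ)))}) : Finset ((Fin 1 ⊕ ((Fin (B + 1) → ℚ) × ℚ)) × (Fin 1 ⊕ ((Fin (B + 1) → ℚ) × ℚ)))))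 :=
    Finset.mem_union_right _ (Finset.mem_insert_of_mem (Finset.mem_singleton_self _))
  by_cases hpos : 0 < u.1 (Fin.last B)
  · have hpos' : 0 < v.1 (Fin.last B) := hsame.1 hpos
    exact ⟨⟨(if 0 < v.1 (Fin.last B) then ((Sum.inr (((Fin.snoc (fun i : Fin B => -v.1 (Fin.castSucc i) / v.1 (Fin.last B)) (1 / v.1 (Fin.last B)) : Fin (B + 1) → ℚ), -v.2 / v.1 (Fin.last B)) : (Fin (B + 1) → ℚ) × ℚ), Sum.inl 0) : ((Fin 1 ⊕ ((Fin (B + 1) → ℚ) × ℚ)) × (Fin 1 ⊕ ((Fin (B + 1) → ℚ) × ℚ)))) else (Sum.inl 0, Sum.inr (((Fin.snoc (fun i : Fin B => -v.1 (Fin.castSucc i) / v.1 (Fin.last B)) (1 / v.1 (Fin.last B)) : Fin (B + 1) → ℚ), -v.2 / v.1 (Fin.last B)) : (Fin (B + 1) → ℚ) × ℚ))), hv, by simp [hpos']⟩, ⟨(if 0 < u.1 (Fin.last B) then ((Sum.inl 0, Sum.inr (((Fin.snoc (fun i : Fin B => -u.1 (Fin.castSucc i) / u.1 (Fin.last B))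 (1 / u.1 (Fin.last B)) : Fin (B + 1) → ℚ), -u.2 / u.1 (Fin.last B)) : (Fin (B + 1) → ℚ) × ℚ)) : ((Fin 1 ⊕ ((Fin (B + 1) → ℚ) × ℚ)) × (Fin 1 ⊕ ((Fin (B + 1) → ℚ) × ℚ)))) else (Sum.inr (((Fin.snoc (fun i : Fin B => -u.1 (Fin.castSucc i) / u.1 (Fin.last B)) (1 / u.1 (Fin.last B)) : Fin (B + 1) → ℚ), -u.2 / u.1 (Fin.last B)) : (Fin (B + 1) → ℚ) × ℚ), Sum.inl 0)), hu, by simp [hpos]⟩⟩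
  · have hpos' : ¬ 0 < v.1 (Fin.last B) := fun h => hpos (hsame.2 h)
    exact ⟨⟨(if 0 < u.1 (Fin.last B) then ((Sum.inl 0, Sum.inr (((Fin.snoc (fun i : Fin B => -u.1 (Fin.castSucc i) / u.1 (Fin.last B)) (1 / u.1 (Fin.last B)) : Fin (B + 1) → ℚ), -u.2 / u.1 (Fin.last B)) : (Fin (B + 1) → ℚ) × ℚ)) : ((Fin 1 ⊕ ((Fin (B + 1) → ℚ) × ℚ)) × (Fin 1 ⊕ ((Fin (B + 1) → ℚ) × ℚ)))) else (Sum.inr (((Fin.snoc (fun i : Fin B => -u.1 (Fin.castSucc i) / u.1 (Fin.last B)) (1 / u.1 (Fin.last B)) : Fin (B + 1) → ℚ), -u.2 / u.1 (Fin.last B)) : (Fin (B + 1) → ℚ) × ℚ), Sum.inl 0)), hu, by simp [hpos]⟩, ⟨(if 0 < v.1 (Fin.last B) then ((Sum.inr (((Fin.snoc (fun i : Fin B => -v.1 (Fin.castSucc i) / v.1 (Fin.last B)) (1 / v.1 (Fin.last B)) : Fin (B + 1) → ℚ), -v.2 / v.1 (Fin.last B)) : (Fin (B + 1) → ℚ)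 × ℚ), Sum.inl 0) : ((Fin 1 ⊕ ((Fin (B + 1) → ℚ) × ℚ)) × (Fin 1 ⊕ ((Fin (B + 1) → ℚ) × ℚ)))) else (Sum.inl 0, Sum.inr (((Fin.snoc (fun i : Fin B => -v.1 (Fin.castSucc i) / v.1 (Fin.last B)) (1 / v.1 (Fin.last B)) : Fin (B + 1) → ℚ), -v.2 / v.1 (Fin.last B)) : (Fin (B + 1) → ℚ) × ℚ))), hv, by simp [hpos']⟩⟩

/-- **The affine players of the swapped band**: `Y`-free forms, `invF u`, or `invF v`. -/
theorem swC_players (M : Fin m' → (Fin (B + 1) → ℚ) × ℚ) (u v : (Fin (B + 1) → ℚ) × ℚ) :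
    ∀ q ∈ ((Finset.univ.image fun j => (if (M j).1 (Fin.last B) = 0 then ((Sum.inr 0, Sum.inr (M j)) : ((Fin 1 ⊕ ((Fin (B + 1) → ℚ) × ℚ)) × (Fin 1 ⊕ ((Fin (B + 1) → ℚ) × ℚ)))) else if 0 < (M j).1 (Fin.last B) then (Sum.inr (((Fin.snoc (fun i : Fin B => -(M j).1 (Fin.castSucc i) / (M j).1 (Fin.last B)) 0 : Fin (B + 1) → ℚ), -(M j).2 / (M j).1 (Fin.last B)) : (Fin (B + 1) → ℚ) × ℚ), Sum.inl 0) else (Sum.inl 0, Sum.inr (((Fin.snoc (fun i : Fin B => -(M j).1 (Fin.castSucc i) / (M j).1 (Fin.last B)) 0 : Fin (B + 1) → ℚ), -(M j).2 / (M j).1 (Fin.last B)) : (Fin (B + 1) → ℚ) × ℚ)))) ∪ (({(if 0 < u.1 (Fin.last B) then ((Sum.inl 0, Sum.inr (((Fin.snoc (fun i : Fin B => -u.1 (Fin.castSucc i) / u.1 (Fin.last B)) (1 / u.1 (Fin.last B)) : Fin (B + 1) → ℚ), -u.2 / u.1 (Fin.last B)) : (Fin (B + 1) → ℚ) × ℚ))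 : ((Fin 1 ⊕ ((Fin (B + 1) → ℚ) × ℚ)) × (Fin 1 ⊕ ((Fin (B + 1) → ℚ) × ℚ)))) else (Sum.inr (((Fin.snoc (fun i : Fin B => -u.1 (Fin.castSucc i) / u.1 (Fin.last B)) (1 / u.1 (Fin.last B)) : Fin (B + 1) → ℚ), -u.2 / u.1 (Fin.last B)) : (Fin (B + 1) → ℚ) × ℚ), Sum.inl 0)), (if 0 < v.1 (Fin.last B) then ((Sum.inr (((Fin.snoc (fun i : Fin B => -v.1 (Fin.castSucc i) / v.1 (Fin.last B)) (1 / v.1 (Fin.last B)) : Fin (B + 1) → ℚ), -v.2 / v.1 (Fin.last B)) : (Fin (B + 1) → ℚ) × ℚ), Sum.inl 0) : ((Fin 1 ⊕ ((Fin (B + 1) → ℚ) × ℚ)) × (Fin 1 ⊕ ((Fin (B + 1) → ℚ) × ℚ)))) else (Sum.inl 0, Sum.inr (((Fin.snoc (fun i : Fin B => -v.1 (Fin.castSucc i) / v.1 (Fin.last B)) (1 / v.1 (Fin.last B)) : Fin (B + 1) → ℚ), -v.2 / v.1 (Fin.last B)) : (Fin (B + 1) → ℚ) × ℚ)))}) :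 Finset ((Fin 1 ⊕ ((Fin (B + 1) → ℚ) × ℚ)) × (Fin 1 ⊕ ((Fin (B + 1) → ℚ) × ℚ))))), ∀ d, (q.1 = Sum.inr d ∨ q.2 = Sum.inr d) →
      d.1 (Fin.last B) = 0 ∨ d = (((Fin.snoc (fun i : Fin B => -u.1 (Fin.castSucc i) / u.1 (Fin.last B)) (1 / u.1 (Fin.last B)) : Fin (B + 1) → ℚ), -u.2 / u.1 (Fin.last B)) : (Fin (B + 1) → ℚ) × ℚ) ∨ d = (((Fin.snoc (fun i : Fin B => -v.1 (Fin.castSucc i) / v.1 (Fin.last B)) (1 / v.1 (Fin.last B)) : Fin (B + 1) → ℚ), -v.2 / v.1 (Fin.last B)) : (Fin (B + 1) → ℚ) × ℚ) := by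
  intro q hq d hd
  rcases Finset.mem_union.1 hq with hq | hq
  · obtain ⟨j, -, rfl⟩ := Finset.mem_image.1 hq
    split_ifs at hd with h0 hpos
    · rcases hd with hd | hd <;> simp only [Sum.inr.injEq] at hd <;> subst hd
      · exact Or.inl rfl
      · exact Or.inl h0
    · rcases hd with hd | hd
      · simp only [Sum.inr.injEq] at hd; subst hd; exact Or.inl (rowF_last _)
      · simp at hd
    · rcases hd with hd | hd
      · simp at hd
      · simp only [Sum.inr.injEq] at hd; subst hd; exact Or.inl (rowF_last _)
  · rcases Finset.mem_insert.1 hq with rfl | hq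
    · split_ifs at hd <;> rcases hd with hd | hd <;> simp only [Sum.inr.injEq] at hd <;>
        exact Or.inr (Or.inl hd.symm)
    · rw [Finset.mem_singleton] at hq
      subst hq
      split_ifs at hd <;> rcases hd with hd | hd <;> simp only [Sum.inr.injEq] at hd <;>
        exact Or.inr (Or.inr hd.symm)

end SwapForms

end RebasePos

/-- Registered support goal of this file (`RebasePos.swC_iff`): the swapped constraints hold at
`w` iff `w ∘ (y t)` lies in the band `{rows, u < t < v}`. -/
theorem rebaseSimplePos_swC_iff (B m' : ℕ) (M : Fin m' → (Fin (B + 1) → ℚ) × ℚ) (u v : (Fin (B + 1) → ℚ) × ℚ) (hu : u.1 (Fin.last B) ≠ 0) (hv : v.1 (Fin.last B) ≠ 0) (w : Fin (B + 1 + 1) → ℝ) : (∀ q ∈ ((Finset.univ.image fun j => (if (M j).1 (Fin.last B) = 0 then ((Sum.inr 0, Sum.inr (M j)) : (Fin 1 ⊕ ((Fin (B + 1) → ℚ) × ℚ)) × (Fin 1 ⊕ ((Fin (B + 1) → ℚ) × ℚ))) else if 0 < (M j).1 (Fin.last B) then (Sum.inr (((Fin.snoc (fun i : Fin B => -(M j).1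 (Fin.castSucc i) / (M j).1 (Fin.last B)) 0 : Fin (B + 1) → ℚ), -(M j).2 / (M j).1 (Fin.last B)) : (Fin (B + 1) → ℚ) × ℚ), Sum.inl 0) else (Sum.inl 0, Sum.inr (((Fin.snoc (fun i : Fin B => -(M j).1 (Fin.castSucc i) / (M j).1 (Fin.last B)) 0 : Fin (B + 1) → ℚ), -(M j).2 / (M j).1 (Fin.last B)) : (Fin (B + 1) → ℚ) × ℚ)))) ∪ ({(if 0 < u.1 (Fin.last B) then ((Sum.inl 0, Sum.inr (((Fin.snoc (fun i : Fin B => -u.1 (Fin.castSucc i) / u.1 (Fin.last B)) (1 / u.1 (Fin.last B)) : Fin (B + 1) → ℚ), -u.2 / u.1 (Fin.last B)) : (Fin (B + 1) → ℚ) × ℚ)) : (Fin 1 ⊕ ((Fin (B + 1) → ℚ) × ℚ)) × (Fin 1 ⊕ ((Fin (B + 1) → ℚ) × ℚ))) else (Sum.inr (((Fin.snoc (fun i : Fin B => -u.1 (Fin.castSucc i) / u.1 (Fin.last B)) (1 / u.1 (Fin.last B)) : Fin (B + 1) → ℚ), -u.2 / u.1 (Fin.last B)) : (Fin (B + 1)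 → ℚ) × ℚ), Sum.inl 0)), (if 0 < v.1 (Fin.last B) then ((Sum.inr (((Fin.snoc (fun i : Fin B => -v.1 (Fin.castSucc i) / v.1 (Fin.last B)) (1 / v.1 (Fin.last B)) : Fin (B + 1) → ℚ), -v.2 / v.1 (Fin.last B)) : (Fin (B + 1) → ℚ) × ℚ), Sum.inl 0) : (Fin 1 ⊕ ((Fin (B + 1) → ℚ) × ℚ)) × (Fin 1 ⊕ ((Fin (B + 1) → ℚ) × ℚ))) else (Sum.inl 0, Sum.inr (((Fin.snoc (fun i : Fin B => -v.1 (Fin.castSucc i) / v.1 (Fin.last B)) (1 / v.1 (Fin.last B)) : Fin (B + 1) → ℚ), -v.2 / v.1 (Fin.last B)) : (Fin (B + 1) → ℚ) × ℚ)))} : Finset ((Fin 1 ⊕ ((Fin (B + 1) → ℚ) × ℚ)) × (Fin 1 ⊕ ((Fin (B + 1) → ℚ) × ℚ))))), RebasePos.pv q.1 w < RebasePos.pv q.2 w) ↔ (fun l : Fin (B + 1 + 1) => w ((Equiv.swap (Fin.castAdd 1 (Fin.last B)) (RebasePos.tI B)) l)) ∈ SeparatePos.gDom B 1 m' M (fun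 _ => Sum.inr u) (fun _ => Sum.inr v) :=
  RebasePos.swC_iff M u v hu hv w

end Summit.KontsevichZagierPeriods.ArrangementNormalForm.JanusBands
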